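import Mathlib
import HarnessLib
import Summits.NavierStokesRegularity.NavierStokesRegularity.Theses.LocalPressureProfileDoor
import Summits.NavierStokesRegularity.NavierStokesRegularity.Theorems.LocalPressureProfileDoorLocalPointZoomSimilarityPressure
import Summits.NavierStokesRegularity.NavierStokesRegularity.Theorems.LocalPressureProfileDoorMonotonePressureProfileRigidity

/-!
# Route `LocalPressureProfileDoor` (nsreg-p1 ROUND-16, door S17⁺ «monotone similarity pressure») — rung-leaf closer: `Target`

Cell ns-regularity-ideate, seat ns-pressure-K2-p1 (DIRECTOR-NS g8 #51, ref3 C262).  The rung leaf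
`Theses.LocalPressureProfileDoor.Target` (stmt-NavierStokesRegularity-20179, rung N0-LocalTubeDoorPressureProfile) is closed BY NAME:
the route's certified deciding theorem `Theses.LocalPressureProfileDoor.closes : LocalPointZoomSimilarityPressure →
MonotonePressureProfileRigidity → Target` applied to the two landed crux theorems
`…Theorems.LocalPressureProfileDoorLocalPointZoomSimilarityPressure.LocalPointZoomSimilarityPressure_proof` (K1, stmt-…-20181) and
`…Theorems.LocalPressureProfileDoorMonotonePressureProfileRigidity.monotonePressureProfileRigidity_proof` (K2⁺, stmt-…-20180, p550500).

The leaf: a classical NS solution on `[0,T)`, Leray–Hopf from a rapidly decaying datum, locally SPACE–TIME Type I at `(x₀,T)`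
(`‖u(t,x)‖(‖x − x₀‖ + √(ν(T − t))) ≤ M` on `B(x₀,ρ) × (T − ρ², T)`), whose similarity Riesz pressure
`P(t,y) = (T − t)·Q[u(t)](x₀ + √(T − t) y)` is asymptotically non-increasing in similarity time (for every shift `σ ∈ [0,1]`,
every `y`, every `ε > 0`, eventually as `t ↑ T`, `P(T − e^{−σ}(T − t), y) − P(t, y) ≤ ε`), is backward bounded at `x₀`.

WHAT THIS IS NOT: not NS regularity and not a Type-I Liouville theorem — it closes the CONDITIONAL rung-leaf door
N0-LocalTubeDoorPressureProfile (local Type I + one similarity window with shift-monotone pressure profile ⇒ regular); the pressure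
monotonicity is a hypothesis (bears_on LADDER-NS N0).
-/

noncomputable section

-- the summit and its single sub-problem share the name (CONVENTIONS §1)
set_option linter.dupNamespace false

namespace Summit.NavierStokesRegularity.NavierStokesRegularity.Theorems.LocalPressureProfileDoorTargetClose

/-- **Item `Target` of route `LocalPressureProfileDoor` holds** (rung leaf S17⁺, stmt-NavierStokesRegularity-20179): the route's
deciding theorem `closes` over the landed crux theorems K1 (`LocalPointZoomSimilarityPressure_proof`: zoom at a backward-unbounded
local space–time Type-I point to a door-class profile with convergent similarity pressure and singular apex) and K2⁺
(`monotonePressureProfileRigidity_proof`: a door-class profile with shift-monotone similarity Riesz pressure is not backward-singular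
at the apex).  Closes the CONDITIONAL rung-leaf N0-LocalTubeDoorPressureProfile (door, not Clay): local Type I + one similarity window
with shift-monotone pressure profile ⇒ regular.  WHAT THIS IS NOT: not NS regularity.
[cite: Tsai1998, §5; PineauVicol2026, Theorem 1.9 and (9.17), arXiv:2607.09619] -/
theorem target_proof : Summit.NavierStokesRegularity.NavierStokesRegularity.Theses.LocalPressureProfileDoor.Target :=
  Summit.NavierStokesRegularity.NavierStokesRegularity.Theses.LocalPressureProfileDoor.closes
    Summit.NavierStokesRegularity.NavierStokesRegularity.Theorems.LocalPressureProfileDoorLocalPointZoomSimilarityPressure.LocalPointZoomSimilarityPressure_proof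
    Summit.NavierStokesRegularity.NavierStokesRegularity.Theorems.LocalPressureProfileDoorMonotonePressureProfileRigidity.monotonePressureProfileRigidity_proof

end Summit.NavierStokesRegularity.NavierStokesRegularity.Theorems.LocalPressureProfileDoorTargetClose

end
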